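import Mathlib
import Summits.Ventures.PercRepro2.Defs
import Summits.Ventures.PercRepro2.Independence
import Summits.Ventures.PercRepro2.Harris
import Summits.Ventures.PercRepro2.Graph
import Summits.Ventures.PercRepro2.Events
import Summits.Ventures.PercRepro2.Induced
import Summits.Ventures.PercRepro2.BHK
import Summits.Ventures.PercRepro2.BHKEvents

/-!
# BHK06 Theorem 1.5, the (−,+) instance, and row 2′H1 in the weighted world
(blind cell PercRepro2, mine-2 g19; proofs/MINE2-JOINTPA.md §2–§3)

Van den Berg–Häggström–Kahn, *Some conditional correlation inequalities for percolation and related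
processes*, Random Structures & Algorithms 29 (2006), doi:10.1002/rsa.20102, Theorem 1.5: conditioned
on `s ↮ t`, two bounded functions of `(C_s, C_t)` that are each increasing in `C_s` and decreasing in
`C_t` are positively correlated.  The tree holds the boundary cases `bhk_same_cluster` (Thm 1.3) and
`bhk_cross_cluster` (Thm 1.4) and the two mixed instances of `BHKMixed.lean`.  This file adds the
instance with one (+,−)-monotone and one (−,+)-monotone indicator:

* `bhk_mixed_anti`: for up-sets `𝓤, 𝓥` (events of `C_s`) and `𝓦` (event of `C_t`),
  `P(C_s ∈ 𝓤 ∩ 𝓥ᶜ, C_t ∈ 𝓦, Q) · P(Q) ≤ P(C_s ∈ 𝓤, Q) · P(C_s ∉ 𝓥, C_t ∈ 𝓦, Q)`,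
  i.e. `Cov(1_𝓤(C_s), 1_{𝓥ᶜ}(C_s) · 1_𝓦(C_t) | Q) ≤ 0` — the BHK06 proof: explore `C_s = W`; on
  `{C_s = W, t ∉ W}` the cluster of `t` is its cluster in `G ∖ W`, so the tower identity
  `prob_clusterIn_inter_eq_expect` writes `P(C_s ∈ 𝓔, C_t ∈ 𝓦, Q) = E[1_𝓔(C_s) g(C_s) 1_Q]` with
  `g = delClusterProb` antitone in `W`; `F₂ = 1 − 1_{𝓥ᶜ} · g` is then a monotone `[0,1]`-valued
  cluster functional and `bhk_same_cluster` with `F₁ = 1_𝓤` gives the claim;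
* `h1_events` / `h1_weighted` (row 2′H1, weighted form): for roots `a₁, a₂` and vertices `b, o, u`,
  conditionally on `Q = {a₁ ↮ a₂}`,
  `Cov_Q(1[b ∈ C₁], 1[o ∈ C₂] + 1[u ∈ C₂] · 1[o ∉ C₁ ∪ C₂]) ≤ 0`
  (multiplied out: `E[L_b F 1_Q] · P(Q) ≤ E[L_b 1_Q] · E[F 1_Q]`), because on `Q` the function
  `F = 1[o ∈ C₂] + 1[u ∈ C₂]·1[o ∉ C₁ ∪ C₂]` equals `1[o ∉ C₁] · 1[{o, u} ∩ C₂ ≠ ∅]`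
  (`F_mul_indicator_Q`) — decreasing in `C₁`, increasing in `C₂` — so `h1_events` is
  `bhk_mixed_anti` with `𝓤 = {b ∈ ·}`, `𝓥 = {o ∈ ·}`, `𝓦 = {o ∈ ·} ∪ {u ∈ ·}`.  The mirror
  (`C₁ ↔ C₂`) is the same statement with the roots exchanged.
-/

namespace Summit.Ventures.PercRepro2

namespace BHKMixedAnti

section Anti

variable {V : Type*} {E : Type*} [Fintype E] [DecidableEq E] [Fintype V] [DecidableEq V]
  {R : Type*} [CommRing R] [LinearOrder R] [IsStrictOrderedRing R]

omit [Fintype E] [DecidableEq E] [Fintype V] [DecidableEq V] in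
/-- The indicator of the complement of an up-set is antitone. -/
lemma antitone_indicator_one_compl_of_isUpperSet {𝓥 : Set (Set V)} (h𝓥 : IsUpperSet 𝓥) :
    Antitone ((𝓥ᶜ).indicator (1 : Set V → R)) := by
  intro W W' h
  by_cases hW' : W' ∈ 𝓥ᶜ
  · have hW : W ∈ 𝓥ᶜ := fun hWv => hW' (h𝓥 h hWv)
    simp [Set.indicator_of_mem hW, Set.indicator_of_mem hW']
  · rw [Set.indicator_of_notMem hW']
    exact Set.indicator_apply_nonneg fun _ => zero_le_one

omit [Fintype E] [DecidableEq E] [Fintype V] [DecidableEq V] in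
/-- `1_𝓔 ≤ 1`. -/
lemma indicator_one_le_one (𝓔 : Set (Set V)) (W : Set V) :
    𝓔.indicator (1 : Set V → R) W ≤ 1 := by
  by_cases hW : W ∈ 𝓔 <;> simp [hW]

/-- **BHK06 Theorem 1.5, the (−,+) instance**: for up-sets `𝓤, 𝓥` (events of `C_s`) and `𝓦`
(event of `C_t`),
`P(C_s ∈ 𝓤 ∩ 𝓥ᶜ, C_t ∈ 𝓦, Q) · P(Q) ≤ P(C_s ∈ 𝓤, Q) · P(C_s ∉ 𝓥, C_t ∈ 𝓦, Q)`, `Q = {s ↮ t}`: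
the increasing `1_𝓤(C_s)` and the (−,+)-monotone `1_{𝓥ᶜ}(C_s) · 1_𝓦(C_t)` are negatively correlated
given `s ↮ t`. -/
theorem bhk_mixed_anti (p : E → R) (hp : IsProbVec p) (ends : E → Sym2 V) (s t : V)
    {𝓤 𝓥 𝓦 : Set (Set V)} (h𝓤 : IsUpperSet 𝓤) (h𝓥 : IsUpperSet 𝓥) (h𝓦 : IsUpperSet 𝓦) :
    prob p (clusterInEvent ends s (𝓤 ∩ 𝓥ᶜ) ∩ clusterInEvent ends t 𝓦 ∩ (connEvent ends s t)ᶜ) *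
        prob p (connEvent ends s t)ᶜ ≤
      prob p (clusterInEvent ends s 𝓤 ∩ (connEvent ends s t)ᶜ) *
        prob p (clusterInEvent ends s 𝓥ᶜ ∩ clusterInEvent ends t 𝓦 ∩ (connEvent ends s t)ᶜ) := by
  classical
  set g := delClusterProb p ends t 𝓦 with hg
  have hg_anti : Antitone g := delClusterProb_anti p hp ends t h𝓦
  have hg0 : ∀ W, 0 ≤ g W := delClusterProb_nonneg p hp ends t 𝓦
  have hg1 : ∀ W, g W ≤ 1 := delClusterProb_le_one p hp ends t 𝓦
  set v := (𝓥ᶜ).indicator (1 : Set V → R) with hv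
  have hv_anti : Antitone v := antitone_indicator_one_compl_of_isUpperSet h𝓥
  have hv0 : ∀ W, 0 ≤ v W := fun W => Set.indicator_apply_nonneg fun _ => zero_le_one
  have hv1 : ∀ W, v W ≤ 1 := indicator_one_le_one 𝓥ᶜ
  -- `F₁ = 1_𝓤`, `F₂ = 1 − 1_{𝓥ᶜ} · g`
  have hF₁ : Monotone (𝓤.indicator (1 : Set V → R)) := monotone_indicator_one_of_isUpperSet h𝓤
  have hF₁0 : ∀ W, 0 ≤ 𝓤.indicator (1 : Set V → R) W :=
    fun W => Set.indicator_apply_nonneg fun _ => zero_le_one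
  have hF₂ : Monotone (fun W => 1 - v W * g W) := by
    intro W W' h
    simp only
    have := mul_le_mul (hv_anti h) (hg_anti h) (hg0 W') (hv0 W)
    linarith
  have hF₂0 : ∀ W, 0 ≤ 1 - v W * g W := fun W => by
    have := mul_le_mul (hv1 W) (hg1 W) (hg0 W) zero_le_one
    linarith
  have key := bhk_same_cluster p hp ends s t hF₁ hF₂ hF₁0 hF₂0
  -- the four expectations as probabilities
  have eU : expect p (fun ω => 𝓤.indicator 1 (cluster ends ω s) *
      ((connEvent ends s t)ᶜ).indicator 1 ω) =
      prob p (clusterInEvent ends s 𝓤 ∩ (connEvent ends s t)ᶜ) :=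
    (prob_clusterInEvent_inter_eq_expect p ends s 𝓤 _).symm
  have eR : expect p (fun ω => ((connEvent ends s t)ᶜ).indicator 1 ω) =
      prob p (connEvent ends s t)ᶜ := (prob_eq_expect_indicator p _).symm
  have eVW := prob_clusterIn_inter_eq_expect p ends s t 𝓥ᶜ 𝓦
  have eUVW := prob_clusterIn_inter_eq_expect p ends s t (𝓤 ∩ 𝓥ᶜ) 𝓦
  have e2 : expect p (fun ω => (1 - v (cluster ends ω s) * g (cluster ends ω s)) *
      ((connEvent ends s t)ᶜ).indicator 1 ω) =
      prob p (connEvent ends s t)ᶜ -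
        prob p (clusterInEvent ends s 𝓥ᶜ ∩ clusterInEvent ends t 𝓦 ∩ (connEvent ends s t)ᶜ) := by
    rw [eVW, ← eR, ← expect_sub]
    congr 1
    funext ω
    simp only [Pi.sub_apply, hv, hg]
    ring
  have e3 : expect p (fun ω => 𝓤.indicator 1 (cluster ends ω s) *
      (1 - v (cluster ends ω s) * g (cluster ends ω s)) *
      ((connEvent ends s t)ᶜ).indicator 1 ω) =
      prob p (clusterInEvent ends s 𝓤 ∩ (connEvent ends s t)ᶜ) -
        prob p (clusterInEvent ends s (𝓤 ∩ 𝓥ᶜ) ∩ clusterInEvent ends t 𝓦 ∩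
          (connEvent ends s t)ᶜ) := by
    rw [eUVW, ← eU, ← expect_sub]
    congr 1
    funext ω
    simp only [Pi.sub_apply, hv, hg, Set.inter_indicator_one, Pi.mul_apply]
    ring
  rw [eU, e2, e3] at key
  nlinarith [key]

end Anti

/-! ## Row 2′H1, weighted form -/

section H1

variable {V : Type*} {E : Type*} [Fintype E] [DecidableEq E] [Fintype V] [DecidableEq V]
  {R : Type*} [CommRing R] [LinearOrder R] [IsStrictOrderedRing R]

omit [Fintype E] [DecidableEq E] [Fintype V] [DecidableEq V] in
/-- `{C_x ∈ {W | v ∈ W}} = {x ↔ v}`. -/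
lemma clusterInEvent_mem_eq (ends : E → Sym2 V) (x v : V) :
    clusterInEvent ends x {W : Set V | v ∈ W} = connEvent ends x v := by
  ext ω
  simp [clusterInEvent, cluster, connEvent]

omit [Fintype E] [DecidableEq E] [Fintype V] [DecidableEq V] in
/-- `{C_x ∈ {W | v ∈ W ∨ v' ∈ W}} = {x ↔ v} ∪ {x ↔ v'}`. -/
lemma clusterInEvent_mem_or_eq (ends : E → Sym2 V) (x v v' : V) :
    clusterInEvent ends x {W : Set V | v ∈ W ∨ v' ∈ W} = connEvent ends x v ∪ connEvent ends x v' := by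
  ext ω
  simp [clusterInEvent, cluster, connEvent]

omit [Fintype E] [DecidableEq E] [Fintype V] [DecidableEq V] in
/-- `{C_x ∈ {W | b ∈ W} ∩ {W | o ∈ W}ᶜ} = {x ↔ b} ∩ {x ↮ o}`. -/
lemma clusterInEvent_mem_inter_compl_eq (ends : E → Sym2 V) (x b o : V) :
    clusterInEvent ends x ({W : Set V | b ∈ W} ∩ {W : Set V | o ∈ W}ᶜ) =
      connEvent ends x b ∩ (connEvent ends x o)ᶜ := by
  ext ω
  simp [clusterInEvent, cluster, connEvent]

omit [Fintype E] [DecidableEq E] [Fintype V] [DecidableEq V] in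
/-- `{C_x ∈ {W | o ∈ W}ᶜ} = {x ↮ o}`. -/
lemma clusterInEvent_compl_mem_eq (ends : E → Sym2 V) (x o : V) :
    clusterInEvent ends x {W : Set V | o ∈ W}ᶜ = (connEvent ends x o)ᶜ := by
  ext ω
  simp [clusterInEvent, cluster, connEvent]

/-- **Row 2′H1 (weighted form), event version.**  For roots `a₁, a₂` and vertices `b, o, u`, with
`Q = {a₁ ↮ a₂}` and `A = {o ∉ C₁} ∩ {o ∈ C₂ ∨ u ∈ C₂}`:
`P(b ∈ C₁, A, Q) · P(Q) ≤ P(b ∈ C₁, Q) · P(A, Q)`. -/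
theorem h1_events (p : E → R) (hp : IsProbVec p) (ends : E → Sym2 V) (a₁ a₂ b o u : V) :
    prob p (connEvent ends a₁ b ∩ (connEvent ends a₁ o)ᶜ ∩
        (connEvent ends a₂ o ∪ connEvent ends a₂ u) ∩ (connEvent ends a₁ a₂)ᶜ) *
      prob p (connEvent ends a₁ a₂)ᶜ ≤
    prob p (connEvent ends a₁ b ∩ (connEvent ends a₁ a₂)ᶜ) *
      prob p ((connEvent ends a₁ o)ᶜ ∩ (connEvent ends a₂ o ∪ connEvent ends a₂ u) ∩
        (connEvent ends a₁ a₂)ᶜ) := by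
  have h𝓤 : IsUpperSet {W : Set V | b ∈ W} := fun _ _ h hW => h hW
  have h𝓥 : IsUpperSet {W : Set V | o ∈ W} := fun _ _ h hW => h hW
  have h𝓦 : IsUpperSet {W : Set V | o ∈ W ∨ u ∈ W} :=
    fun _ _ h hW => hW.elim (fun h1 => Or.inl (h h1)) (fun h2 => Or.inr (h h2))
  have key := bhk_mixed_anti p hp ends a₁ a₂ h𝓤 h𝓥 h𝓦
  rw [clusterInEvent_mem_inter_compl_eq, clusterInEvent_mem_or_eq, clusterInEvent_mem_eq,
    clusterInEvent_compl_mem_eq] at key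
  exact key

omit [Fintype E] [DecidableEq E] [Fintype V] [DecidableEq V] [LinearOrder R]
  [IsStrictOrderedRing R] in
/-- On `Q`, the row's function `F = 1[o ∈ C₂] + 1[u ∈ C₂] · 1[o ∉ C₁ ∪ C₂]` is the indicator of
`A = {o ∉ C₁} ∩ ({o ∈ C₂} ∪ {u ∈ C₂})`: `F · 1_Q = 1_{A ∩ Q}` pointwise. -/
lemma F_mul_indicator_Q (ends : E → Sym2 V) (a₁ a₂ o u : V) (ω : Config E) :
    ((connEvent ends a₂ o).indicator (1 : Config E → R) ω +
        (connEvent ends a₂ u).indicator 1 ω *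
          ((connEvent ends a₁ o ∪ connEvent ends a₂ o)ᶜ).indicator 1 ω) *
      ((connEvent ends a₁ a₂)ᶜ).indicator 1 ω =
    ((connEvent ends a₁ o)ᶜ ∩ (connEvent ends a₂ o ∪ connEvent ends a₂ u) ∩
      (connEvent ends a₁ a₂)ᶜ).indicator 1 ω := by
  by_cases hQ : ω ∈ (connEvent ends a₁ a₂)ᶜ
  · by_cases h1 : ω ∈ connEvent ends a₁ o
    · -- `o ∈ C₁`: then `o ∉ C₂` on `Q`
      have h2 : ω ∉ connEvent ends a₂ o := fun h2 => hQ (conn_trans h1 (conn_symm h2))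
      by_cases h3 : ω ∈ connEvent ends a₂ u <;> simp [hQ, h1, h2, h3]
    · by_cases h2 : ω ∈ connEvent ends a₂ o <;> by_cases h3 : ω ∈ connEvent ends a₂ u <;>
        simp [hQ, h1, h2, h3]
  · simp [hQ]

/-- **Row 2′H1 (weighted form; night-3 g6 / mine-2 g18, CONJECTURES v2.99jm l.54) is a theorem.**
For roots `a₁, a₂` and vertices `b, o, u`, with `L_b = 1[b ∈ C₁]`,
`F = 1[o ∈ C₂] + 1[u ∈ C₂] · 1[o ∉ C₁ ∪ C₂]` and `Q = {a₁ ↮ a₂}`: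
`E[L_b · F · 1_Q] · P(Q) ≤ E[L_b · 1_Q] · E[F · 1_Q]`, i.e. `Cov_Q(L_b, F) ≤ 0` — an instance of
BHK06 Theorem 1.5, since on `Q` the function `F` is `1[o ∉ C₁] · 1[{o, u} ∩ C₂ ≠ ∅]`, decreasing in
`C₁` and increasing in `C₂`.  The mirror (`C₁ ↔ C₂`) is the statement with `a₁, a₂` exchanged. -/
theorem h1_weighted (p : E → R) (hp : IsProbVec p) (ends : E → Sym2 V) (a₁ a₂ b o u : V) :
    expect p (fun ω => (connEvent ends a₁ b).indicator (1 : Config E → R) ω *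
        ((connEvent ends a₂ o).indicator 1 ω + (connEvent ends a₂ u).indicator 1 ω *
          ((connEvent ends a₁ o ∪ connEvent ends a₂ o)ᶜ).indicator 1 ω) *
        ((connEvent ends a₁ a₂)ᶜ).indicator 1 ω) *
      prob p (connEvent ends a₁ a₂)ᶜ ≤
    expect p (fun ω => (connEvent ends a₁ b).indicator (1 : Config E → R) ω *
        ((connEvent ends a₁ a₂)ᶜ).indicator 1 ω) *
      expect p (fun ω => ((connEvent ends a₂ o).indicator (1 : Config E → R) ω +
        (connEvent ends a₂ u).indicator 1 ω *
          ((connEvent ends a₁ o ∪ connEvent ends a₂ o)ᶜ).indicator 1 ω) *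
        ((connEvent ends a₁ a₂)ᶜ).indicator 1 ω) := by
  have key := h1_events p hp ends a₁ a₂ b o u
  have e1 : expect p (fun ω => (connEvent ends a₁ b).indicator (1 : Config E → R) ω *
      ((connEvent ends a₂ o).indicator 1 ω + (connEvent ends a₂ u).indicator 1 ω *
        ((connEvent ends a₁ o ∪ connEvent ends a₂ o)ᶜ).indicator 1 ω) *
      ((connEvent ends a₁ a₂)ᶜ).indicator 1 ω) =
      prob p (connEvent ends a₁ b ∩ (connEvent ends a₁ o)ᶜ ∩
        (connEvent ends a₂ o ∪ connEvent ends a₂ u) ∩ (connEvent ends a₁ a₂)ᶜ) := by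
    rw [prob_eq_expect_indicator]
    congr 1
    funext ω
    rw [mul_assoc, F_mul_indicator_Q, ← indicator_inter_one]
    congr 1
    ext ω'
    simp only [Set.mem_inter_iff]
    tauto
  have e2 : expect p (fun ω => (connEvent ends a₁ b).indicator (1 : Config E → R) ω *
      ((connEvent ends a₁ a₂)ᶜ).indicator 1 ω) =
      prob p (connEvent ends a₁ b ∩ (connEvent ends a₁ a₂)ᶜ) := by
    rw [prob_eq_expect_indicator]
    congr 1
    funext ω
    rw [indicator_inter_one]
  have e3 : expect p (fun ω => ((connEvent ends a₂ o).indicator (1 : Config E → R) ω +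
      (connEvent ends a₂ u).indicator 1 ω *
        ((connEvent ends a₁ o ∪ connEvent ends a₂ o)ᶜ).indicator 1 ω) *
      ((connEvent ends a₁ a₂)ᶜ).indicator 1 ω) =
      prob p ((connEvent ends a₁ o)ᶜ ∩ (connEvent ends a₂ o ∪ connEvent ends a₂ u) ∩
        (connEvent ends a₁ a₂)ᶜ) := by
    rw [prob_eq_expect_indicator]
    congr 1
    funext ω
    exact F_mul_indicator_Q ends a₁ a₂ o u ω
  rw [e1, e2, e3]
  exact key

end H1

end BHKMixedAnti

end Summit.Ventures.PercRepro2
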